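import Summits.CriticalPhenomena.PercolationContinuityZ3.Theorems.AdditiveGluing.Negative.CertSearchH
import Summits.CriticalPhenomena.PercolationContinuityZ3.Theorems.AdditiveGluing.Negative.CertBlockPrune
import Summits.CriticalPhenomena.PercolationContinuityZ3.Theorems.AdditiveGluing.Negative.CertWitness

/-!
# `AdditiveGluing` (crux stmt-CriticalPhenomena-4576, route `PercNearOneGluing`):
# the certificate at density `1/2` for EVERY simple graph on at most SEVEN vertices
# (block-pruned search; computational, `native_decide`)

The search of `CertIsoSix.lean` visits all `2^{n(n-1)/2}` labelled graphs and prunes only at the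
leaves; at `n = 7` (`2^21` leaves) that is out of reach.  Here the vertex pairs are processed in
DECREASING order of their code bit (`pairsDesc`), so that after the last pair `(r, r+1)` of row `r` the
induced subgraph on the top block `{r, …, n−1}` is complete; the subtree is pruned as soon as some
permutation fixing the vertices `< r` lowers the (high part of the) code (`CertBlockPrune`:
a code-minimal graph survives every such test).  At `r = 0` the test is full code-minimality, so the
surviving leaves are one graph per isomorphism class (`1044` on `Fin 7`), each checked by the fast
histogram check `checkDH` of `CertSearchH.lean` (additive gluing AND Kozma–Nitzan Conjecture 1).

* `pairsDesc`, `goB`, `blkL`, `agIsoB` — the search; `pairwise_pairsDesc` — the order is strict;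
* `goB_imp` — every sub-list is either pruned at a block boundary (with the high part of its final
  code) or reaches `checkDH`;
* `exists_checkDH_of_agIsoB` — for `G` take `σ*` minimising `codeG (G.map σ)`; its leaf is never
  pruned (`not_lt_hiPart_of_minimal`), so `checkDH` passed on an edge list of `G.map σ*`;
* `additiveGluing_half_of_agIsoB`, `knConj1_half_of_agIsoB` (counts moved to `edgeList` by
  `cntConn_congr`/`cntConnSet_congr`, then transported back to `G` as in `CertIsoSix`);
* `agIsoB_seven` (`native_decide`, ≈ 150 s) and the certificates `additiveGluing_half_le_seven`,
  `additiveGluing_indicatorHalf_le_seven`, `knConj1_half_le_seven`.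

Nothing here asserts the crux.
-/

namespace Summit.CriticalPhenomena.PercolationContinuityZ3.Theorems.AdditiveGluing.Negative.Cert

open MeasureTheory
open Literature.Probability.Percolation Literature.Probability.LatticeModels

/-! ### The block-pruned search (computable) -/

section Checker

/-- The vertex pairs in decreasing order of their code bit. -/
def pairsDesc (n : ℕ) : List (Fin n × Fin n) :=
  List.mergeSort (allPairs n) (fun p q => Nat.ble (slot n q.1 q.2) (slot n p.1 p.2))

/-- The search: at the last pair `(r, r+1)` of a row, prune if some recoding in `blk r` lowers the
code; at a leaf, run the fast per-graph check. -/
def goB (n : ℕ) (blk : ℕ → List (List (ℕ × ℕ))) : List (Fin n × Fin n) → List (List ℕ × ℕ) → ℕ → Bool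
  | [], d, _ => checkDH n d
  | p :: ps, d, c =>
    ((decide (p.2.val = p.1.val + 1) && lowersL (blk p.1.val) c) || goB n blk ps d c) &&
    ((decide (p.2.val = p.1.val + 1) && lowersL (blk p.1.val) (c ||| 2 ^ slot n p.1 p.2)) ||
      goB n blk ps (stepH d p.1 p.2) (c ||| 2 ^ slot n p.1 p.2))

/-- For each `r`: the recodings of the permutations fixing every vertex below `r`. -/
def blkL (n : ℕ) : List (List (List (ℕ × ℕ))) :=
  (List.range n).map fun r => ((permTabs n).filter (fixesBelow r)).map (smPairs n)

/-- THE BLOCK-PRUNED CHECK at density `1/2`: every simple graph on `Fin n` up to isomorphism. -/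
def agIsoB (n : ℕ) : Bool :=
  let bl := blkL n
  goB n (fun r => bl.getD r []) (pairsDesc n) [(List.range n, 1)] 0

end Checker

/-! ### The order and the accumulated code -/

/-- `pairsDesc n` lists the pairs of `allPairs n`. -/
theorem mem_pairsDesc {n : ℕ} (p : Fin n × Fin n) : p ∈ pairsDesc n ↔ p.1 < p.2 := by
  rw [pairsDesc, List.mem_mergeSort, mem_allPairs]

/-- The order is strictly decreasing in the code bit. -/
theorem pairwise_pairsDesc (n : ℕ) : (pairsDesc n).Pairwise fun p q => slot n q.1 q.2 < slot n p.1 p.2 := by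
  have h1 : (pairsDesc n).Pairwise fun p q => Nat.ble (slot n q.1 q.2) (slot n p.1 p.2) = true :=
    List.pairwise_mergeSort (le := fun p q : Fin n × Fin n => Nat.ble (slot n q.1 q.2) (slot n p.1 p.2))
      (fun a b c hab hbc => by simp only [Nat.ble_eq] at hab hbc ⊢; omega)
      (fun a b => by simp only [Nat.ble_eq, Bool.or_eq_true]; omega) (allPairs n)
  have h2 : (pairsDesc n).Nodup := (List.mergeSort_perm _ _).nodup_iff.2 (nodup_allPairs n)
  refine (h1.and h2).imp fun {p q} h => ?_
  obtain ⟨hle, hne⟩ := h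
  rw [Nat.ble_eq] at hle
  refine lt_of_le_of_ne hle fun heq => hne ?_
  obtain ⟨e1, e2⟩ := slot_inj q.2.2 p.2.2 heq
  exact (Prod.ext (Fin.ext e1) (Fin.ext e2)).symm

/-- The high part of an accumulated code whose new pairs all lie below `B` is the start code (if the
start code has no bit below `B`). -/
theorem hiPart_codeAcc {n : ℕ} {B c : ℕ} {es : List (Fin n × Fin n)} (hes : ∀ q ∈ es, slot n q.1 q.2 < B)
    (hc : ∀ k, c.testBit k = true → B ≤ k) : hiPart B (codeAcc n c es) = c := by
  apply Nat.eq_of_testBit_eq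
  intro k
  rw [testBit_hiPart]
  by_cases hk : B ≤ k
  · simp only [hk, decide_true, Bool.true_and]
    rw [Bool.eq_iff_iff, testBit_codeAcc]
    constructor
    · rintro (h | ⟨q, hq, hqk⟩)
      · exact h
      · exact absurd (hqk ▸ hes q hq) (not_lt.2 hk)
    · exact Or.inl
  · simp only [hk, decide_false, Bool.false_and]
    cases h : c.testBit k
    · rfl
    · exact absurd (hc k h) hk

/-- **What the search guarantees.** Along a strictly decreasing list of pairs, from a code with no
bit at or below the remaining pairs: every sub-list is either pruned at some block boundary `(r, r+1)`
— with argument the high part of its final code — or reaches the per-graph check. -/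
theorem goB_imp {n : ℕ} (blk : ℕ → List (List (ℕ × ℕ))) : ∀ (ps : List (Fin n × Fin n))
    (d : List (List ℕ × ℕ)) (c : ℕ), (ps.Pairwise fun p q => slot n q.1 q.2 < slot n p.1 p.2) →
    (∀ k, c.testBit k = true → ∀ q ∈ ps, slot n q.1 q.2 < k) → goB n blk ps d c = true →
    ∀ es ∈ ps.sublists',
      (∃ p ∈ ps, p.2.val = p.1.val + 1 ∧
        lowersL (blk p.1.val) (hiPart (slot n p.1 p.2) (codeAcc n c es)) = true) ∨
      checkDH n (es.foldl (fun d q => stepH d q.1 q.2) d) = true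
  | [], d, c, _, _, h, es, hes => by
    rw [List.sublists'_nil, List.mem_singleton] at hes
    subst hes
    exact Or.inr (by simpa [goB] using h)
  | p :: ps, d, c, hsort, hc, h, es, hes => by
    rw [List.pairwise_cons] at hsort
    rw [goB, Bool.and_eq_true, Bool.or_eq_true, Bool.or_eq_true, Bool.and_eq_true, Bool.and_eq_true,
      decide_eq_true_eq] at h
    obtain ⟨hA, hB⟩ := h
    have hcp : ∀ k, c.testBit k = true → slot n p.1 p.2 < k := fun k hk => hc k hk p List.mem_cons_self
    rw [List.sublists'_cons, List.mem_append, List.mem_map] at hes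
    rcases hes with hes | ⟨es', hes', rfl⟩
    · -- `p` excluded
      have hsub : ∀ q ∈ es, slot n q.1 q.2 < slot n p.1 p.2 := fun q hq =>
        hsort.1 q ((List.mem_sublists'.1 hes).subset hq)
      rcases hA with ⟨hbd, hlow⟩ | hgo
      · refine Or.inl ⟨p, List.mem_cons_self, hbd, ?_⟩
        rwa [hiPart_codeAcc hsub fun k hk => (hcp k hk).le]
      · rcases goB_imp blk ps d c hsort.2 (fun k hk q hq => hc k hk q (List.mem_cons_of_mem _ hq)) hgo es hes
          with ⟨p', hp', h'⟩ | h'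
        · exact Or.inl ⟨p', List.mem_cons_of_mem _ hp', h'⟩
        · exact Or.inr h'
    · -- `p` included
      have hsub : ∀ q ∈ es', slot n q.1 q.2 < slot n p.1 p.2 := fun q hq =>
        hsort.1 q ((List.mem_sublists'.1 hes').subset hq)
      have hc1 : ∀ k, (c ||| 2 ^ slot n p.1 p.2).testBit k = true → slot n p.1 p.2 ≤ k := by
        intro k hk
        rw [Nat.testBit_or, Bool.or_eq_true, Nat.testBit_two_pow, decide_eq_true_eq] at hk
        rcases hk with hk | rfl
        · exact (hcp k hk).le
        · exact le_rfl
      have hacc : codeAcc n c (p :: es') = codeAcc n (c ||| 2 ^ slot n p.1 p.2) es' := rfl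
      rcases hB with ⟨hbd, hlow⟩ | hgo
      · refine Or.inl ⟨p, List.mem_cons_self, hbd, ?_⟩
        rwa [hacc, hiPart_codeAcc hsub hc1]
      · rcases goB_imp blk ps _ _ hsort.2 (fun k hk q hq => lt_of_lt_of_le (hsort.1 q hq) (hc1 k hk)) hgo es' hes'
          with ⟨p', hp', h'⟩ | h'
        · exact Or.inl ⟨p', List.mem_cons_of_mem _ hp', hacc ▸ h'⟩
        · exact Or.inr h'

/-! ### Edge lists of a graph along `pairsDesc` -/

/-- The edge list of `G` in the order of `pairsDesc`. -/
noncomputable def edgeListDesc {n : ℕ} (G : SimpleGraph (Fin n)) : List (Fin n × Fin n) :=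
  haveI := Classical.decRel G.Adj
  (pairsDesc n).filter fun p => G.Adj p.1 p.2

/-- Membership in `edgeListDesc`. -/
theorem mem_edgeListDesc {n : ℕ} (G : SimpleGraph (Fin n)) (p : Fin n × Fin n) :
    p ∈ edgeListDesc G ↔ p.1 < p.2 ∧ G.Adj p.1 p.2 := by
  unfold edgeListDesc
  simp only [List.mem_filter, mem_pairsDesc, decide_eq_true_eq]

/-- `edgeListDesc G` is a sub-list of `pairsDesc n`. -/
theorem edgeListDesc_sublist {n : ℕ} (G : SimpleGraph (Fin n)) : (edgeListDesc G).Sublist (pairsDesc n) := by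
  unfold edgeListDesc; exact List.filter_sublist

/-- Its accumulated code is the code of the graph. -/
theorem codeAcc_edgeListDesc {n : ℕ} (G : SimpleGraph (Fin n)) : codeAcc n 0 (edgeListDesc G) = codeG G := by
  apply Nat.eq_of_testBit_eq
  intro k
  rw [Bool.eq_iff_iff, testBit_codeAcc, testBit_codeG]
  simp only [Nat.zero_testBit, Bool.false_eq_true, false_or, mem_edgeListDesc]
  constructor
  · rintro ⟨p, ⟨hp, hadj⟩, rfl⟩; exact ⟨p.1, p.2, hp, hadj, rfl⟩
  · rintro ⟨i, j, hij, hadj, rfl⟩; exact ⟨(i, j), ⟨hij, hadj⟩, rfl⟩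

/-- It has the same edge set as `edgeList G`. -/
theorem Eset_edgeListDesc {n : ℕ} (G : SimpleGraph (Fin n)) : Eset (edgeListDesc G) = Eset (edgeList G) := by
  ext e
  induction e using Sym2.ind with
  | _ x y =>
    rw [mem_Eset_iff, mem_Eset_iff]
    simp only [mem_edgeListDesc, mem_edgeList]

/-- Its unordered images are distinct. -/
theorem nodup_map_mkE_edgeListDesc {n : ℕ} (G : SimpleGraph (Fin n)) : ((edgeListDesc G).map mkE).Nodup := by
  have hnd : (edgeListDesc G).Nodup :=
    ((List.mergeSort_perm _ _).nodup_iff.2 (nodup_allPairs n)).sublist (edgeListDesc_sublist G)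
  refine hnd.map_on fun p hp q hq hpq => ?_
  have hp' := ((mem_edgeListDesc G p).1 hp).1
  have hq' := ((mem_edgeListDesc G q).1 hq).1
  obtain ⟨c, d⟩ := q
  rcases (mkE_eq_iff p c d).1 hpq with rfl | rfl
  · rfl
  · exact absurd (hp'.trans hq') (lt_irrefl _)

/-- Counts only depend on the edge set: two-point. -/
theorem cntConn_congr {n : ℕ} {es₁ es₂ : List (Fin n × Fin n)} (h1 : (es₁.map mkE).Nodup)
    (h2 : (es₂.map mkE).Nodup) (hE : Eset es₁ = Eset es₂) (o b : Fin n) :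
    cntConn (tables n es₁) o b = cntConn (tables n es₂) o b := by
  rw [cntConn_eq_card h1, cntConn_eq_card h2, hE]

/-- Counts only depend on the edge set: point-to-set (masks below `2^n`). -/
theorem cntConnSet_congr {n : ℕ} {es₁ es₂ : List (Fin n × Fin n)} (h1 : (es₁.map mkE).Nodup)
    (h2 : (es₂.map mkE).Nodup) (hE : Eset es₁ = Eset es₂) (o : Fin n) {Am : ℕ} (hAm : Am < 2 ^ n) :
    cntConnSet (tables n es₁) o Am = cntConnSet (tables n es₂) o Am := by
  rw [← maskL_toList_finsetOfMask hAm, cntConnSet_eq_card h1, cntConnSet_eq_card h2, hE]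

/-- Lengths only depend on the edge set. -/
theorem length_congr {n : ℕ} {es₁ es₂ : List (Fin n × Fin n)} (h1 : (es₁.map mkE).Nodup)
    (h2 : (es₂.map mkE).Nodup) (hE : Eset es₁ = Eset es₂) : es₁.length = es₂.length := by
  rw [← length_eq_card_Eset h1, ← length_eq_card_Eset h2, hE]

/-! ### Soundness of the block-pruned search -/

/-- The heart: for every graph some relabelling of it reached the per-graph check, along its
`pairsDesc`-ordered edge list. -/
theorem exists_checkDH_of_agIsoB {n : ℕ} (h : agIsoB n = true) (G : SimpleGraph (Fin n)) :
    ∃ σ : Equiv.Perm (Fin n),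
      checkDH n ((edgeListDesc (G.map σ)).foldl (fun d q => stepH d q.1 q.2) [(List.range n, 1)]) = true := by
  classical
  obtain ⟨σ, -, hmin⟩ := Finset.exists_min_image Finset.univ
    (fun σ : Equiv.Perm (Fin n) => codeG (G.map σ)) Finset.univ_nonempty
  refine ⟨σ, ?_⟩
  set G' := G.map σ with hG'
  have hmin' : ∀ σ' : Equiv.Perm (Fin n), codeG G' ≤ codeG (G'.map σ') := fun σ' => by
    rw [hG', codeG_map_map]; exact hmin (σ.trans σ') (Finset.mem_univ _)
  rcases goB_imp (fun r => (blkL n).getD r []) (pairsDesc n) _ 0 (pairwise_pairsDesc n)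
      (fun k hk => by simp at hk) h (edgeListDesc G') (List.mem_sublists'.2 (edgeListDesc_sublist G'))
    with ⟨p, hp, hbd, hlow⟩ | hcheck
  · exfalso
    have hp1 : p.1.val < n := p.1.2
    rw [blkL, getD_map_range _ _ hp1] at hlow
    obtain ⟨sp, hsp, hlt⟩ := exists_of_lowersL hlow
    obtain ⟨τ, hτmem, rfl⟩ := List.mem_map.1 hsp
    rw [List.mem_filter] at hτmem
    obtain ⟨σ', hσ'⟩ := exists_perm_of_mem_permTabs hτmem.1
    have hfix := fix_of_fixesBelow hτmem.2 hσ'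
    rw [recodeL_smPairs, codeAcc_edgeListDesc] at hlt
    have hslot : slot n p.1 p.2 = slot n p.1 (p.1 + 1) := by rw [hbd]
    rw [hslot] at hlt
    exact not_lt_hiPart_of_minimal G' hmin' σ' hfix τ hσ' hlt
  · exact hcheck

/-- The counts of a graph from a `checkDH` along `edgeListDesc`. -/
theorem counts_of_checkDH_edgeListDesc {n : ℕ} (G : SimpleGraph (Fin n))
    (h : checkDH n ((edgeListDesc G).foldl (fun d q => stepH d q.1 q.2) [(List.range n, 1)]) = true)
    (o b : Fin n) {Am : ℕ} (hAm : Am < 2 ^ n) (hAm0 : Am ≠ 0) :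
    ∃ a : Fin n, Am.testBit a = true ∧
      cntConnSet (tables n (edgeList G)) o Am ≤ cntConn (tables n (edgeList G)) o b +
        (2 ^ (edgeList G).length - cntConn (tables n (edgeList G)) a b) ∧
      cntConnSet (tables n (edgeList G)) o Am * cntConn (tables n (edgeList G)) a b ≤
        cntConn (tables n (edgeList G)) o b * 2 ^ (edgeList G).length := by
  have h1 := nodup_map_mkE_edgeListDesc G
  have h2 : ((edgeList G).map mkE).Nodup := nodup_map_mk_of_sublist (edgeList_sublist G)
  have hE := Eset_edgeListDesc G
  obtain ⟨a, hta, hle1, hle2⟩ := checkDH_spec h o b hAm hAm0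
  refine ⟨a, hta, ?_, ?_⟩
  · rwa [cntConnSet_congr h1 h2 hE o hAm, cntConn_congr h1 h2 hE, cntConn_congr h1 h2 hE,
      length_congr h1 h2 hE] at hle1
  · rwa [cntConnSet_congr h1 h2 hE o hAm, cntConn_congr h1 h2 hE, cntConn_congr h1 h2 hE,
      length_congr h1 h2 hE] at hle2

/-- **Soundness (additive gluing).** If `agIsoB n = true` then the additive gluing inequality holds
for `bondPercolation G half` on EVERY simple graph `G` on `Fin n`, all `A o b t`. -/
theorem additiveGluing_half_of_agIsoB {n : ℕ} (h : agIsoB n = true) (G : SimpleGraph (Fin n))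
    (A : Finset (Fin n)) (o b : Fin n) (t : ℝ) (ht : 0 ≤ t)
    (hrel : ∀ a ∈ A, 1 - t ≤ (bondPercolation G half).real (openConn a b)) :
    (bondPercolation G half).real (⋃ a ∈ A, openConn o a) - t ≤
      (bondPercolation G half).real (openConn o b) := by
  classical
  obtain ⟨σ, hcheck⟩ := exists_checkDH_of_agIsoB h G
  have hAG := additiveGluing_half_of_counts (G.map σ) (fun o b _ hAm hAm0 =>
      (counts_of_checkDH_edgeListDesc _ hcheck o b hAm hAm0).imp fun a ha => ⟨ha.1, ha.2.1⟩)
    (A.image σ) (σ o) (σ b) t ht (by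
      intro a' ha'
      obtain ⟨a, ha, rfl⟩ := Finset.mem_image.1 ha'
      rw [real_openConn_map]
      exact hrel a ha)
  rw [Finset.set_biUnion_finset_image, real_iUnion_openConn_map, real_openConn_map] at hAG
  exact hAG

/-- **Soundness (Kozma–Nitzan Conjecture 1).** If `agIsoB n = true` then
`P(o ↔ A) · s ≤ P(o ↔ b)` whenever `s ≤ P(a ↔ b)` for all `a ∈ A`, on EVERY simple graph on `Fin n`. -/
theorem knConj1_half_of_agIsoB {n : ℕ} (h : agIsoB n = true) (G : SimpleGraph (Fin n))
    (A : Finset (Fin n)) (o b : Fin n) (s : ℝ)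
    (hrel : ∀ a ∈ A, s ≤ (bondPercolation G half).real (openConn a b)) :
    (bondPercolation G half).real (⋃ a ∈ A, openConn o a) * s ≤
      (bondPercolation G half).real (openConn o b) := by
  classical
  obtain ⟨σ, hcheck⟩ := exists_checkDH_of_agIsoB h G
  have hC := knConj1_half_of_counts (G.map σ) (fun o b _ hAm hAm0 =>
      (counts_of_checkDH_edgeListDesc _ hcheck o b hAm hAm0).imp fun a ha => ⟨ha.1, ha.2.2⟩)
    (A.image σ) (σ o) (σ b) s (by
      intro a' ha'
      obtain ⟨a, ha, rfl⟩ := Finset.mem_image.1 ha'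
      rw [real_openConn_map]
      exact hrel a ha)
  rw [Finset.set_biUnion_finset_image, real_iUnion_openConn_map, real_openConn_map] at hC
  exact hC

/-! ### The certificates: all simple graphs on at most seven vertices -/

/-- **The certified computation** `agIsoB 7 = true`: all simple graphs on `Fin 7` by the
block-pruned search (one surviving leaf per isomorphism class, `1044` of them, each checked for both
inequalities and all `(o, b, A)`; `native_decide`, ≈ 150 s). -/
theorem agIsoB_seven : agIsoB 7 = true := by native_decide

/-- **Certificate (additive gluing, density `1/2`, at most seven vertices).** For every simple graph
`G` on `Fin n`, `n ≤ 7`, under Bernoulli bond percolation with density `1/2`, every relay set `A`,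
vertices `o b` and slack `t ≥ 0` with `P(a ↔ b) ≥ 1 − t` for all `a ∈ A` satisfy
`P(o ↔ A) − t ≤ P(o ↔ b)`. -/
theorem additiveGluing_half_le_seven {n : ℕ} (hn : n ≤ 7) (G : SimpleGraph (Fin n))
    (A : Finset (Fin n)) (o b : Fin n) (t : ℝ) (ht : 0 ≤ t)
    (hrel : ∀ a ∈ A, 1 - t ≤ (bondPercolation G half).real (openConn a b)) :
    (bondPercolation G half).real (⋃ a ∈ A, openConn o a) - t ≤
      (bondPercolation G half).real (openConn o b) := by
  rcases Nat.lt_or_ge n 7 with h6 | h7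
  · exact additiveGluing_half_le_six (by omega) G A o b t ht hrel
  · have : n = 7 := le_antisymm hn h7
    subst this
    exact additiveGluing_half_of_agIsoB agIsoB_seven G A o b t ht hrel

/-- The same certificate in the literal `prodBernoulli` shape of the crux. -/
theorem additiveGluing_indicatorHalf_le_seven {n : ℕ} (hn : n ≤ 7) (G : SimpleGraph (Fin n))
    [DecidablePred (· ∈ G.edgeSet)] (A : Finset (Fin n)) (o b : Fin n) (t : ℝ) (ht : 0 ≤ t)
    (hrel : ∀ a ∈ A, 1 - t ≤
      (prodBernoulli fun e => if e ∈ G.edgeSet then half else 0).real (openConn a b)) :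
    (prodBernoulli fun e => if e ∈ G.edgeSet then half else 0).real (⋃ a ∈ A, openConn o a) - t ≤
      (prodBernoulli fun e => if e ∈ G.edgeSet then half else 0).real (openConn o b) := by
  rw [prodBernoulli_indicator_holds] at hrel ⊢
  exact additiveGluing_half_le_seven hn G A o b t ht hrel

/-- **Certificate (Kozma–Nitzan Conjecture 1, density `1/2`, at most seven vertices).** For every
simple graph `G` on `Fin n`, `n ≤ 7`, under `P_{1/2}`, every relay set `A`, vertices `o b` and `s`
with `s ≤ P(a ↔ b)` for all `a ∈ A`: `P(o ↔ A) · s ≤ P(o ↔ b)`. -/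
theorem knConj1_half_le_seven {n : ℕ} (hn : n ≤ 7) (G : SimpleGraph (Fin n))
    (A : Finset (Fin n)) (o b : Fin n) (s : ℝ)
    (hrel : ∀ a ∈ A, s ≤ (bondPercolation G half).real (openConn a b)) :
    (bondPercolation G half).real (⋃ a ∈ A, openConn o a) * s ≤
      (bondPercolation G half).real (openConn o b) := by
  rcases Nat.lt_or_ge n 7 with h6 | h7
  · exact knConj1_half_le_six (by omega) G A o b s hrel
  · have : n = 7 := le_antisymm hn h7
    subst this
    exact knConj1_half_of_agIsoB agIsoB_seven G A o b s hrel

end Summit.CriticalPhenomena.PercolationContinuityZ3.Theorems.AdditiveGluing.Negative.Cert
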